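import Summits.CriticalPhenomena.CardyFormulaZ2.Theorems.CardyComplexConeSLESixFamiliesGiveCardyLowerRunPart1

/-!
# Stub `stub_upperFence` of line `collar-touch-sandwich` (crux `SLESixFamiliesGiveCardy`,
stmt-CriticalPhenomena-9654) — helper: dual-wired sites inside `closure Ω` are close to the touch set

drefute gen-3 candidate helper (the UPPER twin of the lead's landed
`lowerRun_wired_near_touch`, `…LowerRunPart1.lean`).  In the fence argument for STATEMENT A the
exploration crosses an `ω`-open edge `e` of the crossing path `π ⊆ Ω_δ`; a crossed edge is
`bcBondConfig`-closed, so `e` has an endpoint `w ∈ zdArcB (Λ δ)` whose mesh point lies in `Ω`,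
and the trace passes through the midpoint of `e`, at distance `δ/2` from `δw`.  This file supplies
the last step: under `UpperCollarGeom R D G`, for all small meshes every site of the dual-wired
arc `zdArcB (Λ δ)` whose mesh point lies in `closure Ω` is within `η/2` of `G` — it is `2δ`-close
to `∂D` (`exists_mem_frontier_dist_le_of_mem_zdBoundary`), hence (`≤`-rule of `zdDiscreteArc`,
whatever the designer's arc datum `arcB` is) `2δ`-close to `arcB`, hence (Hausdorff guard
`tendsto_arcB`) `o(1)`-close to a point of `D.arc 1` near `closure Ω`, and such points are near
`D.arc 1 ∩ closure Ω ⊆ G` (compactness of `D.arc 1`, `arc_one_inter_closure_subset`).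
-/

noncomputable section

open Set Filter Topology Metric
open scoped NNReal
open Literature.Probability Literature.Probability.RandomPlanarGeometry
  Literature.Probability.LatticeModels Literature.Probability.Percolation

namespace Summit.CriticalPhenomena.CardyFormulaZ2.Cruxes.SLESixFamiliesGiveCardy.CollarTouchSandwich

/-- **Dual-wired sites inside `closure Ω` are close to the touch set, eventually** (helper of
`stub_upperFence`).  Under `UpperCollarGeom R D G`, for a discretisation family `Λ` of `D` and
`η > 0`, for all small meshes `δ` every site of the dual-wired arc `zdArcB (Λ δ)` whose mesh point
lies in `closure Ω` is within `η / 2` of `G`. -/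
theorem upperFence_dual_near_touch :
    ∀ (R : ConformalRectangle) (D : DobrushinDomain) (G : Set ℂ), UpperCollarGeom R D G →
      ∀ (Λ : ℝ → DiscreteDobrushin), ZdDiscretisationFamily D Λ → ∀ η : ℝ, 0 < η →
        ∀ᶠ δ : ℝ in 𝓝[>] 0, ∀ x ∈ (Λ δ).zdArcB, meshPoint δ x ∈ closure R.carrier →
          infDist (meshPoint δ x) G ≤ η / 2 := by
  intro R D G hgeom Λ hΛ η hη
  -- the far part of the dual-wired arc is a compact set missing `closure Ω`
  set K : Set ℂ := D.arc 1 ∩ {g | η / 4 ≤ infDist g G} with hK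
  have hKc : IsCompact K :=
    (D.isCompact_arc 1).inter_right (isClosed_le continuous_const (continuous_infDist_pt G))
  have hKd : Disjoint K (closure R.carrier) := by
    refine Set.disjoint_left.2 fun g hg hgΩ => ?_
    have hgG : g ∈ G := hgeom.arc_one_inter_closure_subset ⟨hg.1, hgΩ⟩
    have : η / 4 ≤ infDist g G := hg.2
    rw [infDist_zero_of_mem hgG] at this
    linarith
  obtain ⟨ρ₀, hρ₀, hfar⟩ :=
    exists_pos_forall_lt_infDist hKc isClosed_closure hKd (R.nonempty.mono subset_closure)
  set τ := min (ρ₀ / 2) (η / 8) with hτ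
  have hτpos : 0 < τ := by positivity
  have hτρ : τ ≤ ρ₀ / 2 := min_le_left _ _
  have hτη : τ ≤ η / 8 := min_le_right _ _
  have e3 : ∀ᶠ δ : ℝ in 𝓝[>] 0, hausdorffEDist (Λ δ).arcB (D.arc 1) < ENNReal.ofReal τ :=
    hΛ.tendsto_arcB (Iio_mem_nhds (ENNReal.ofReal_pos.2 hτpos))
  filter_upwards [eventually_mesh_pos, eventually_mesh_lt (by positivity : 0 < τ / 3), e3] with δ
    hδ hδτ hH x hxB hxΩ
  have hΩ := hΛ.Ω_eq δ
  have hδE := hΛ.δ_eq δ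
  obtain ⟨hxbd, hxle⟩ := ((Λ δ).mem_zdDiscreteArc_iff).1 hxB
  rw [hδE] at hxle
  obtain ⟨p, hp, hpx⟩ := exists_mem_frontier_dist_le_of_mem_zdBoundary (E := Λ δ)
    (by rw [hΩ]; exact D.isOpen) (by rw [hδE]; exact hδ.le) hxbd
  rw [hδE] at hpx
  -- `2δ`-close to the arc datum, whatever it is
  have hA : infDist (meshPoint δ x) (Λ δ).arcB ≤ 2 * δ := by
    by_cases hpB : p ∈ (Λ δ).arcB
    · exact (infDist_le_dist_of_mem hpB).trans hpx
    · exact hxle.trans ((infDist_le_dist_of_mem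
        (show p ∈ frontier (Λ δ).Ω \ (Λ δ).arcB from ⟨hp, hpB⟩)).trans hpx)
  -- `o(1)`-close to the dual-wired arc of `D`
  have h0 : infDist (meshPoint δ x) (D.arc 1) < 2 * δ + τ :=
    (infDist_le_infDist_add_hausdorffDist hH.ne_top).trans_lt (by
      have hHD : hausdorffDist (Λ δ).arcB (D.arc 1) < τ := ENNReal.toReal_lt_of_lt_ofReal hH
      linarith)
  obtain ⟨g, hg, hgx⟩ := (infDist_lt_iff (⟨_, D.pt_mem_arc_self 1⟩ : (D.arc 1).Nonempty)).1 h0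
  -- that point of the dual arc is near `closure Ω`, hence near `G`
  have hgΩ : infDist g (closure R.carrier) < ρ₀ :=
    (infDist_le_dist_of_mem hxΩ).trans_lt (by rw [dist_comm]; linarith)
  have hgG : infDist g G < η / 4 := by
    by_contra hcon
    exact lt_asymm hgΩ (hfar g ⟨hg, not_lt.1 hcon⟩)
  have := infDist_le_infDist_add_dist (x := meshPoint δ x) (y := g) (s := G)
  linarith

/-- The same for sites whose mesh point lies in `Ω` itself (the form met by the fence argument:
the `B`-endpoint of the crossed edge is a vertex of the crossing path, a mesh vertex of `Ω`). -/
theorem upperFence_dual_near_touch' {R : ConformalRectangle} {D : DobrushinDomain} {G : Set ℂ}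
    (hgeom : UpperCollarGeom R D G) {Λ : ℝ → DiscreteDobrushin} (hΛ : ZdDiscretisationFamily D Λ)
    {η : ℝ} (hη : 0 < η) :
    ∀ᶠ δ : ℝ in 𝓝[>] 0, ∀ x ∈ (Λ δ).zdArcB, meshPoint δ x ∈ R.carrier →
      infDist (meshPoint δ x) G ≤ η / 2 := by
  filter_upwards [upperFence_dual_near_touch R D G hgeom Λ hΛ η hη] with δ h x hx hxΩ
  exact h x hx (subset_closure hxΩ)

end Summit.CriticalPhenomena.CardyFormulaZ2.Cruxes.SLESixFamiliesGiveCardy.CollarTouchSandwich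

end
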